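import Summits.Ventures.DiscreteObjects.Hadamard.AutomorphismTransfer668

/-!
# A signed automorphism of odd prime order of a Hadamard matrix can be re-signed to a permutation automorphism (kernel, general)

Framing: lottery ticket; floor = certified bounds/negative ranges.

Cell pub-namedobj (venture DiscreteObjects), target (H), hadamard gen 7 (FAMILY-F12-G7 §2).  Let `H` be a Hadamard matrix with a
signed-permutation automorphism `(π, κ, d, e)` (`H (π i) (κ j) = d i * e j * H i j`), `π ^ p = κ ^ p = 1`, `p` ODD (e.g. an odd prime order).
Then there are signs `s, t : ι → {±1}` such that `H' i j := s i * t j * H i j` — a Hadamard matrix equivalent to `H` — satisfies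
`H' (π i) (κ j) = H' i j`: the SAME permutations act as a pure permutation automorphism pair.  Proof: iterating the automorphism
`p` times gives `D i * E j = 1` for the cycle products `D i = ∏_{k<p} d (π^k i)`, `E j = ∏_{k<p} e (κ^k j)`, so all `D i`, `E j` equal one
sign `δ`; replacing `(d, e)` by `(δ d, δ e)` (still an automorphism) makes every cycle product `1` (`p` odd); then the explicit
potential `s i := ∏_{k<p} ∏_{l<k} d (π^l i)` satisfies `s (π i) = d i * s i` by telescoping (again `p` odd), similarly `t`.
With `OrbitSums` this puts the Hadamard form `Θ Θᵀ = n·I` of the orbit matrix at the disposal of every odd prime in the census.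
Ours, not literature; no `sorry`.
-/

open Finset BigOperators Matrix

namespace Summit.Ventures.DiscreteObjects.Hadamard

open Literature.Combinatorics.Designs.GoethalsSeidel (IsHadamardMatrix)

variable {ι : Type*} [Fintype ι] [DecidableEq ι]

section potential
variable (π : Equiv.Perm ι) (d : ι → ℤ)

/-- partial cycle product `S i k = ∏_{l<k} d (π^l i)` -/
def cyc (i : ι) (k : ℕ) : ℤ := ∏ l ∈ Finset.range k, d ((π ^ l) i)

/-- the re-signing potential `s i = ∏_{k<p} S i k` -/
def pot (p : ℕ) (i : ι) : ℤ := ∏ k ∈ Finset.range p, cyc π d i k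

omit [Fintype ι] [DecidableEq ι] in
/-- a product of `±1` values is `±1` -/
lemma prod_pm {α : Type*} (s : Finset α) (f : α → ℤ) (hf : ∀ a ∈ s, f a = 1 ∨ f a = -1) :
    ∏ a ∈ s, f a = 1 ∨ ∏ a ∈ s, f a = -1 := by
  classical
  induction s using Finset.induction_on with
  | empty => left; simp
  | insert a s ha ih =>
    rw [Finset.prod_insert ha]
    have h1 := hf a (Finset.mem_insert_self a s)
    have h2 := ih (fun b hb => hf b (Finset.mem_insert_of_mem hb))
    rcases h1 with h | h <;> rcases h2 with h' | h' <;> simp [h, h']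

omit [Fintype ι] [DecidableEq ι] in
/-- partial cycle products of `±1` signs are `±1` -/
lemma cyc_pm (hd : ∀ i, d i = 1 ∨ d i = -1) (i : ι) (k : ℕ) : cyc π d i k = 1 ∨ cyc π d i k = -1 :=
  prod_pm _ _ (fun _ _ => hd _)

omit [Fintype ι] [DecidableEq ι] in
/-- the potential takes values `±1` -/
lemma pot_pm (hd : ∀ i, d i = 1 ∨ d i = -1) (p : ℕ) (i : ι) : pot π d p i = 1 ∨ pot π d p i = -1 :=
  prod_pm _ _ (fun k _ => cyc_pm π d hd i k)

omit [Fintype ι] [DecidableEq ι] in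
/-- shifting the start of the partial product: `S i (k+1) = d i * S (π i) k` -/
lemma cyc_succ (i : ι) (k : ℕ) : cyc π d i (k + 1) = d i * cyc π d (π i) k := by
  unfold cyc
  rw [Finset.prod_range_succ']
  simp only [pow_zero, Equiv.Perm.one_apply, pow_succ, Equiv.Perm.mul_apply]
  ring

omit [Fintype ι] [DecidableEq ι] in
/-- **telescoping**: if the full cycle product `S i p` is `1` and `p` is odd then `s (π i) = d i * s i` -/
lemma pot_apply_perm (hd : ∀ i, d i = 1 ∨ d i = -1) {p : ℕ} (hodd : Odd p) (i : ι) (hD : cyc π d i p = 1) :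
    pot π d p (π i) = d i * pot π d p i := by
  have hdi : d i * d i = 1 := pm_mul_self (hd i)
  -- pot (π i) = ∏_{k<p} cyc (π i) k = ∏_{k<p} d i * cyc i (k+1)
  have e1 : pot π d p (π i) = ∏ k ∈ Finset.range p, (d i * cyc π d i (k + 1)) := by
    unfold pot
    apply Finset.prod_congr rfl
    intro k _
    have := cyc_succ π d i k
    -- cyc i (k+1) = d i * cyc (π i) k  ⇒  cyc (π i) k = d i * cyc i (k+1)
    calc cyc π d (π i) k = (d i * d i) * cyc π d (π i) k := by rw [hdi, one_mul]
      _ = d i * (d i * cyc π d (π i) k) := by ring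
      _ = d i * cyc π d i (k + 1) := by rw [← this]
  rw [e1, Finset.prod_mul_distrib, Finset.prod_const, Finset.card_range]
  -- ∏_{k<p} cyc i (k+1) = ∏_{k<p} cyc i k, using cyc i 0 = 1 and cyc i p = 1
  have e2 : ∏ k ∈ Finset.range p, cyc π d i (k + 1) = pot π d p i := by
    have h := Finset.prod_range_succ' (fun k => cyc π d i k) p
    have h' := Finset.prod_range_succ (fun k => cyc π d i k) p
    have h0 : cyc π d i 0 = 1 := by unfold cyc; simp
    rw [h0, mul_one] at h
    rw [hD, mul_one] at h'
    unfold pot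
    rw [← h', h]
  rw [e2, Odd.pow_eq_self_of_pm hodd (hd i)]
where
  /-- helper: for `x = ±1` and odd `p`, `x ^ p = x` -/
  Odd.pow_eq_self_of_pm {p : ℕ} (hodd : Odd p) {x : ℤ} (hx : x = 1 ∨ x = -1) : x ^ p = x := by
    rcases hx with rfl | rfl
    · exact one_pow p
    · exact Odd.neg_one_pow hodd

end potential

omit [Fintype ι] [DecidableEq ι] in
/-- iterating a signed automorphism `k` times -/
lemma signedAut_pow {H : Matrix ι ι ℤ} {π κ : Equiv.Perm ι} {d e : ι → ℤ} (haut : IsSignedAut H π κ d e) (k : ℕ)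
    (i j : ι) : H ((π ^ k) i) ((κ ^ k) j) = cyc π d i k * cyc κ e j k * H i j := by
  induction k generalizing i j with
  | zero => simp [cyc]
  | succ k ih =>
    rw [pow_succ, pow_succ, Equiv.Perm.mul_apply, Equiv.Perm.mul_apply, ih (π i) (κ j), haut.2.2 i j,
      cyc_succ π d i k, cyc_succ κ e j k]
    ring

/-- **Re-signing.**  A signed automorphism with `π ^ p = κ ^ p = 1` for an ODD `p` (e.g. an odd prime order) becomes a pure
permutation automorphism of an equivalent Hadamard matrix `H' i j = s i * t j * H i j` with the same permutations `(π, κ)`. -/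
theorem exists_resign_of_odd {H : Matrix ι ι ℤ} (hH : IsHadamardMatrix H) {π κ : Equiv.Perm ι} {d e : ι → ℤ}
    (haut : IsSignedAut H π κ d e) {p : ℕ} (hodd : Odd p) (hπ : π ^ p = 1) (hκ : κ ^ p = 1) :
    ∃ s t : ι → ℤ, (∀ i, s i = 1 ∨ s i = -1) ∧ (∀ j, t j = 1 ∨ t j = -1) ∧
      IsHadamardMatrix (Matrix.of fun i j => s i * t j * H i j) ∧
      ∀ i j, s (π i) * t (κ j) * H (π i) (κ j) = s i * t j * H i j := by
  obtain ⟨hd, he, hrel⟩ := haut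
  -- empty index type: trivial
  rcases isEmpty_or_nonempty ι with hι | ⟨⟨i₀⟩⟩
  · refine ⟨fun _ => 1, fun _ => 1, fun i => (IsEmpty.false i).elim, fun j => (IsEmpty.false j).elim, ?_, fun i => (IsEmpty.false i).elim⟩
    refine ⟨fun i => (IsEmpty.false i).elim, ?_⟩
    ext i; exact (IsEmpty.false i).elim
  -- cycle products
  have hDE : ∀ i j, cyc π d i p * cyc κ e j p = 1 := by
    intro i j
    have h := signedAut_pow ⟨hd, he, hrel⟩ p i j
    rw [hπ, hκ, Equiv.Perm.one_apply, Equiv.Perm.one_apply] at h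
    have hne : H i j ≠ 0 := pm_ne_zero (hH.1 i j)
    have : (cyc π d i p * cyc κ e j p - 1) * H i j = 0 := by linarith
    rcases mul_eq_zero.mp this with h0 | h0
    · linarith
    · exact (hne h0).elim
  -- the common sign δ
  set δ := cyc π d i₀ p with hδ
  have hδpm : δ = 1 ∨ δ = -1 := cyc_pm π d hd i₀ p
  have hδδ : δ * δ = 1 := pm_mul_self hδpm
  have hE : ∀ j, cyc κ e j p = δ := by
    intro j
    have h := hDE i₀ j
    calc cyc κ e j p = (δ * δ) * cyc κ e j p := by rw [hδδ, one_mul]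
      _ = δ * (δ * cyc κ e j p) := by ring
      _ = δ := by rw [h, mul_one]
  have hD : ∀ i, cyc π d i p = δ := by
    intro i
    have h := hDE i i₀
    rw [hE i₀] at h
    calc cyc π d i p = cyc π d i p * (δ * δ) := by rw [hδδ, mul_one]
      _ = (cyc π d i p * δ) * δ := by ring
      _ = δ := by rw [h, one_mul]
  -- re-signed characters d' = δ d, e' = δ e: still an automorphism, cycle products 1
  set d' : ι → ℤ := fun i => δ * d i with hd'
  set e' : ι → ℤ := fun j => δ * e j with he'
  have hd'pm : ∀ i, d' i = 1 ∨ d' i = -1 := by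
    intro i; rcases hδpm with h | h <;> rcases hd i with h2 | h2 <;> simp [hd', h, h2]
  have he'pm : ∀ j, e' j = 1 ∨ e' j = -1 := by
    intro j; rcases hδpm with h | h <;> rcases he j with h2 | h2 <;> simp [he', h, h2]
  have hrel' : ∀ i j, H (π i) (κ j) = d' i * e' j * H i j := by
    intro i j
    rw [hrel i j]
    simp only [hd', he']
    calc d i * e j * H i j = (δ * δ) * (d i * e j * H i j) := by rw [hδδ, one_mul]
      _ = δ * d i * (δ * e j) * H i j := by ring
  have cyc_scale : ∀ (σ : Equiv.Perm ι) (f : ι → ℤ) (i : ι) (k : ℕ),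
      cyc σ (fun x => δ * f x) i k = δ ^ k * cyc σ f i k := by
    intro σ f i k
    unfold cyc
    rw [Finset.prod_mul_distrib, Finset.prod_const, Finset.card_range]
  have hδp : δ ^ p = δ := by
    rcases hδpm with h | h
    · rw [h, one_pow]
    · rw [h]; exact Odd.neg_one_pow hodd
  have hD' : ∀ i, cyc π d' i p = 1 := by
    intro i; rw [hd', cyc_scale, hδp, hD i, hδδ]
  have hE' : ∀ j, cyc κ e' j p = 1 := by
    intro j; rw [he', cyc_scale, hδp, hE j, hδδ]
  -- the potentials
  refine ⟨pot π d' p, pot κ e' p, pot_pm π d' hd'pm p, pot_pm κ e' he'pm p, ?_, ?_⟩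
  · -- Hadamard property of the re-signed matrix
    refine ⟨?_, ?_⟩
    · intro i j
      simp only [Matrix.of_apply]
      rcases pot_pm π d' hd'pm p i with h1 | h1 <;> rcases pot_pm κ e' he'pm p j with h2 | h2 <;>
        rcases hH.1 i j with h3 | h3 <;> simp [h1, h2, h3]
    · ext a b
      rw [Matrix.mul_apply, Matrix.smul_apply, smul_eq_mul]
      simp only [Matrix.transpose_apply, Matrix.of_apply]
      have hab := congrFun (congrFun hH.2 a) b
      rw [Matrix.mul_apply, Matrix.smul_apply, smul_eq_mul] at hab
      simp only [Matrix.transpose_apply] at hab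
      have ht : ∀ j, pot κ e' p j * pot κ e' p j = 1 := fun j => pm_mul_self (pot_pm κ e' he'pm p j)
      calc ∑ j, pot π d' p a * pot κ e' p j * H a j * (pot π d' p b * pot κ e' p j * H b j)
          = pot π d' p a * pot π d' p b * ∑ j, (pot κ e' p j * pot κ e' p j) * (H a j * H b j) := by
            rw [Finset.mul_sum]; apply Finset.sum_congr rfl; intro j _; ring
        _ = pot π d' p a * pot π d' p b * ∑ j, H a j * H b j := by
            congr 1; apply Finset.sum_congr rfl; intro j _; rw [ht j, one_mul]
        _ = pot π d' p a * pot π d' p b * ((Fintype.card ι : ℤ) * (1 : Matrix ι ι ℤ) a b) := by rw [hab]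
        _ = (Fintype.card ι : ℤ) * (1 : Matrix ι ι ℤ) a b := by
            by_cases h : a = b
            · subst h; rw [pm_mul_self (pot_pm π d' hd'pm p a), one_mul]
            · rw [Matrix.one_apply_ne h]; ring
  · intro i j
    rw [pot_apply_perm π d' hd'pm hodd i (hD' i), pot_apply_perm κ e' he'pm hodd j (hE' j), hrel' i j]
    have h1 : d' i * d' i = 1 := pm_mul_self (hd'pm i)
    have h2 : e' j * e' j = 1 := pm_mul_self (he'pm j)
    calc d' i * pot π d' p i * (e' j * pot κ e' p j) * (d' i * e' j * H i j)
        = (d' i * d' i) * (e' j * e' j) * (pot π d' p i * pot κ e' p j * H i j) := by ring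
      _ = pot π d' p i * pot κ e' p j * H i j := by rw [h1, h2, one_mul, one_mul]

end Summit.Ventures.DiscreteObjects.Hadamard
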